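import Mathlib
import HarnessLib

/-!
# Algebraic core of Proposition Z (the only zeroth-order Lyapunov density of 3D Navier–Stokes is the energy)

Soloist (blind) report `sharpest.md` v16 §2.8.

*Proposition Z.* Let `g ∈ C¹(ℝ³) ∩ C²(ℝ³ \ {0})`, `g(0) = 0`, `|∇g(u)| ≤ C(1+|u|)^N`.  If for every Schwartz
divergence-free datum the map `t ↦ ∫ g(u(x,t)) dx` is non-increasing for small times along the Navier–Stokes
solution (`ν > 0`), then `g(u) = a·u + (α/2)|u|²` with `α ≥ 0`: the functional is `α ×` the kinetic energy.  In
particular no `L^p`-type quantity `∫|u|^p`, `1 < p < ∞`, `p ≠ 2` (the critical `L³` norm included), no anisotropic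
moment `∫|u·e|^p` and no Orlicz functional `∫Φ(|u|)` other than the energy is monotone along all solutions.
The proof in the report has four steps; this file certifies the finite-dimensional / one-variable skeleton of each:
* `scaling_signs` — Step 1 (spreading `u₀(x/L)`): if `L² N + ν L D ≤ 0` for all `L > 0` then `N ≤ 0` and `D ≤ 0`
  (the Euler rate `N` and the viscous rate `D` of the functional acquire separate signs);
* `forced_zero_of_nonpos` — Step 2 (parity `w ↦ -w(-x)` composed with `w ↦ -w`): a functional that is `≤ 0`
  everywhere and satisfies `N(w♯) = -N(-w)` vanishes identically;
* `axialVec_mul_eq_zero_iff_commute` — Step 3 (localisation): for symmetric `M = g''(c)` and `H = ∇²p(x)`,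
  `curl (M ∇p) = 0`, i.e. the axial vector of `M H` vanishes, iff `M H = H M`;
* `scalar_of_commute_traceless_symm` — Step 4: a `3 × 3` matrix commuting with every traceless symmetric matrix
  (the far-field pressure Hessians realised by ringlet shells, Lemma C of §2.7) is scalar; hence `g'' = α·Id`;
* `rankOne_shift_not_scalar` — the corollary engine: `Id + t c cᵀ` (the shape of the Hessian of `|u|^p` at
  `c ≠ 0`, `t = p - 2` up to a positive factor) is scalar only if `t = 0`;
* `scalar_of_commute_swaps_two` — the 2D control of Step 4; `bidegree_collision` — the exponent bookkeeping of
  the first-order programme (which dissipation can screen which Euler rate on the family `λ u₀(x/L)`).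
The analysis (local well-posedness in the Schwartz class, the pressure representation, de Rham's lemma on a ball,
Lemma C) is proved in the report, not here.

The linter option `linter.dupNamespace` is disabled because the mandated landing namespace repeats the summit name by
design (D-0017). [problem: ns]
-/

set_option linter.dupNamespace false

namespace Summit.NavierStokesRegularity.NavierStokesRegularity.Theorems

open Matrix

/-! ### Step 1: the spreading family separates the Euler rate from the viscous rate -/

/-- If `L² N + ν L D ≤ 0` for every `L > 0` (the rate of the functional along the datum `u₀(x/L)`), then
`N ≤ 0` and `D ≤ 0`. -/
theorem scaling_signs (N D ν : ℝ) (hν : 0 < ν)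
    (h : ∀ L : ℝ, 0 < L → L ^ 2 * N + ν * L * D ≤ 0) : N ≤ 0 ∧ D ≤ 0 := by
  constructor
  · by_contra hN
    push Not at hN
    set L := (ν * |D| + 1) / N with hL
    have hLpos : 0 < L := by
      rw [hL]; positivity
    have key := h L hLpos
    have hLN : L * N = ν * |D| + 1 := by
      rw [hL]; field_simp
    have : L ^ 2 * N + ν * L * D = L * (L * N + ν * D) := by ring
    rw [this, hLN] at key
    have hinner : 0 < ν * |D| + 1 + ν * D := by
      have habs : 0 ≤ |D| + D := by
        have := neg_abs_le D
        linarith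
      nlinarith
    have : 0 < L * (ν * |D| + 1 + ν * D) := mul_pos hLpos hinner
    linarith
  · by_contra hD
    push Not at hD
    set L := ν * D / (2 * (|N| + 1)) with hL
    have hLpos : 0 < L := by
      rw [hL]; positivity
    have key := h L hLpos
    have hLN : L * (|N| + 1) = ν * D / 2 := by
      rw [hL]; field_simp
    have hNle : -(|N| + 1) ≤ N := by
      have := neg_abs_le N
      linarith
    have h1 : L * N ≥ -(ν * D / 2) := by
      have := mul_le_mul_of_nonneg_left hNle hLpos.le
      linarith
    have h2 : 0 < L * (L * N + ν * D) := by
      apply mul_pos hLpos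
      nlinarith
    have : L ^ 2 * N + ν * L * D = L * (L * N + ν * D) := by ring
    linarith

/-! ### Step 2: parity forces a signed Euler rate to vanish -/

/-- Abstract form of the parity argument: on the Schwartz divergence-free fields let `neg w = -w` and
`sharp w = -w(-·)`.  The Euler rate `N` of `∫ g(u)` obeys `N (sharp w) = - N (neg w)` (the pressure gradient is odd
under `x ↦ -x`, `∇g(w)` is not).  If moreover `N ≤ 0` everywhere (Step 1), then `N ≡ 0`. -/
theorem forced_zero_of_nonpos {X : Type*} (N : X → ℝ) (neg sharp : X → X)
    (hneg : Function.Surjective neg) (hrel : ∀ w, N (sharp w) = -N (neg w)) (hle : ∀ w, N w ≤ 0) :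
    ∀ w, N w = 0 := by
  intro w
  obtain ⟨v, rfl⟩ := hneg w
  have h1 := hle (neg v)
  have h2 := hle (sharp v)
  rw [hrel v] at h2
  linarith

/-! ### Step 3: `curl (M ∇p) = 0` on a ball is the commutation `[M, ∇²p] = 0` -/

/-- The axial vector of (twice) the antisymmetric part of a `3 × 3` matrix:
`(N₃₂ - N₂₃, N₁₃ - N₃₁, N₂₁ - N₁₂)`.  For `N = M ∇²p` with constant `M` this is `curl (M ∇p)`:
`(curl (M∇p))ᵢ = εᵢⱼₖ ∂ⱼ (M ∇p)ₖ = εᵢⱼₖ (M ∇²p)ₖⱼ`. -/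
def axialVec (N : Matrix (Fin 3) (Fin 3) ℝ) : Fin 3 → ℝ :=
  ![N 2 1 - N 1 2, N 0 2 - N 2 0, N 1 0 - N 0 1]

/-- The axial vector of `N` vanishes iff `N` is symmetric. -/
theorem axialVec_eq_zero_iff (N : Matrix (Fin 3) (Fin 3) ℝ) : axialVec N = 0 ↔ Nᵀ = N := by
  constructor
  · intro h
    have h0 := congrFun h 0
    have h1 := congrFun h 1
    have h2 := congrFun h 2
    simp [axialVec] at h0 h1 h2
    ext i j
    fin_cases i <;> fin_cases j <;> simp [Matrix.transpose_apply] <;> linarith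
  · intro h
    have e := fun i j => congrFun (congrFun h i) j
    have e01 := e 0 1
    have e02 := e 0 2
    have e12 := e 1 2
    simp only [Matrix.transpose_apply] at e01 e02 e12
    ext i
    fin_cases i <;> simp [axialVec] <;> linarith

/-- For symmetric `M` (a Hessian `g''(c)`) and symmetric `H` (a pressure Hessian `∇²p(x)`):
`curl (M ∇p) = 0`, i.e. `axialVec (M H) = 0`, if and only if `M` and `H` commute. -/
theorem axialVec_mul_eq_zero_iff_commute (M H : Matrix (Fin 3) (Fin 3) ℝ)
    (hM : Mᵀ = M) (hH : Hᵀ = H) : axialVec (M * H) = 0 ↔ M * H = H * M := by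
  rw [axialVec_eq_zero_iff, Matrix.transpose_mul, hM, hH]
  exact eq_comm

/-! ### Step 4: commuting with the traceless symmetric matrices forces a scalar -/

/-- The traceless symmetric matrix `E₁₂ + E₂₁`. -/
def swap01 : Matrix (Fin 3) (Fin 3) ℝ := !![0, 1, 0; 1, 0, 0; 0, 0, 0]

/-- The traceless symmetric matrix `E₁₃ + E₃₁`. -/
def swap02 : Matrix (Fin 3) (Fin 3) ℝ := !![0, 0, 1; 0, 0, 0; 1, 0, 0]

/-- `E₁₂ + E₂₁` is symmetric. -/
theorem swap01_transpose : swap01ᵀ = swap01 := by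
  ext i j; fin_cases i <;> fin_cases j <;> simp [swap01]

/-- `E₁₃ + E₃₁` is symmetric. -/
theorem swap02_transpose : swap02ᵀ = swap02 := by
  ext i j; fin_cases i <;> fin_cases j <;> simp [swap02]

/-- `E₁₂ + E₂₁` is traceless. -/
theorem swap01_trace : swap01.trace = 0 := by
  simp [Matrix.trace, Fin.sum_univ_three, swap01]

/-- `E₁₃ + E₃₁` is traceless. -/
theorem swap02_trace : swap02.trace = 0 := by
  simp [Matrix.trace, Fin.sum_univ_three, swap02]

/-- A `3 × 3` real matrix commuting with `E₁₂ + E₂₁` and `E₁₃ + E₃₁` is scalar. -/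
theorem scalar_of_commute_swaps (M : Matrix (Fin 3) (Fin 3) ℝ)
    (h01 : M * swap01 = swap01 * M) (h02 : M * swap02 = swap02 * M) :
    M = M 0 0 • (1 : Matrix (Fin 3) (Fin 3) ℝ) := by
  have e := fun i j => congrFun (congrFun h01 i) j
  have f := fun i j => congrFun (congrFun h02 i) j
  have a01 := e 0 1
  have a02 := e 0 2
  have a12 := e 1 2
  have a20 := e 2 0
  have a21 := e 2 1
  have b02 := f 0 2
  have b01 := f 0 1
  have b10 := f 1 0
  have b12 := f 1 2
  have b21 := f 2 1
  simp [swap01, swap02, Matrix.mul_apply, Fin.sum_univ_three] at a01 a02 a12 a20 a21 b02 b01 b10 b12 b21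
  ext i j
  fin_cases i <;> fin_cases j <;> simp <;> linarith

/-- STEP 4 OF PROPOSITION Z.  If `M` commutes with every traceless symmetric `3 × 3` matrix — in the report: with
every far-field pressure Hessian `∇²p_R(0)` realised by ringlet shells (Lemma C(iii) of §2.7: these span `Sym₀(3)`) —
then `M` is a multiple of the identity.  Applied to `M = g''(c)` for every `c ≠ 0` this gives `g'' = α(c)·Id`,
whence `g(u) = a·u + (α/2)|u|²` with a constant `α`. -/
theorem scalar_of_commute_traceless_symm (M : Matrix (Fin 3) (Fin 3) ℝ)
    (h : ∀ Q : Matrix (Fin 3) (Fin 3) ℝ, Qᵀ = Q → Q.trace = 0 → M * Q = Q * M) :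
    ∃ α : ℝ, M = α • (1 : Matrix (Fin 3) (Fin 3) ℝ) :=
  ⟨M 0 0, scalar_of_commute_swaps M (h _ swap01_transpose swap01_trace) (h _ swap02_transpose swap02_trace)⟩

/-! ### Corollary engine: the Hessian of `|u|^p` is scalar only for `p = 2` -/

/-- `Id + t • c cᵀ = α • Id` with `c ≠ 0` forces `t = 0`.  The Hessian of `u ↦ |u|^p` at `c ≠ 0` is
`p|c|^{p-2}(Id + (p-2) ĉ ĉᵀ)`; so among the radial powers only `p = 2` passes Step 4. -/
theorem rankOne_shift_not_scalar (c : Fin 3 → ℝ) (hc : c ≠ 0) (t α : ℝ)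
    (h : (1 : Matrix (Fin 3) (Fin 3) ℝ) + t • Matrix.vecMulVec c c = α • (1 : Matrix (Fin 3) (Fin 3) ℝ)) :
    t = 0 := by
  have e := fun i j => congrFun (congrFun h i) j
  have d0 := e 0 0
  have d1 := e 1 1
  have d2 := e 2 2
  have o01 := e 0 1
  have o02 := e 0 2
  have o12 := e 1 2
  simp [Matrix.vecMulVec_apply] at d0 d1 d2 o01 o02 o12
  -- off-diagonal: t = 0 ∨ cᵢ = 0 ∨ cⱼ = 0; diagonal: 1 + t cᵢ² = α for every i
  by_contra ht
  have p01 : c 0 = 0 ∨ c 1 = 0 := by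
    rcases o01 with h' | h'
    · exact absurd h' ht
    · exact h'
  have q01 : c 0 * c 0 = c 1 * c 1 := by
    have : t * (c 0 * c 0 - c 1 * c 1) = 0 := by linarith
    rcases mul_eq_zero.mp this with h' | h'
    · exact absurd h' ht
    · linarith
  have q02 : c 0 * c 0 = c 2 * c 2 := by
    have : t * (c 0 * c 0 - c 2 * c 2) = 0 := by linarith
    rcases mul_eq_zero.mp this with h' | h'
    · exact absurd h' ht
    · linarith
  -- hence all components vanish
  have h0 : c 0 = 0 := by
    rcases p01 with h' | h'
    · exact h'
    · have : c 0 * c 0 = 0 := by rw [q01, h']; ring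
      exact mul_self_eq_zero.mp this
  have h1 : c 1 = 0 := by
    have : c 1 * c 1 = 0 := by rw [← q01, h0]; ring
    exact mul_self_eq_zero.mp this
  have h2 : c 2 = 0 := by
    have : c 2 * c 2 = 0 := by rw [← q02, h0]; ring
    exact mul_self_eq_zero.mp this
  apply hc
  ext i
  fin_cases i <;> simp [h0, h1, h2]

/-! ### 2D control and the bidegree bookkeeping of the first-order programme -/

/-- 2D CONTROL of Step 4: a `2 × 2` matrix commuting with the traceless symmetric `E₁₂ + E₂₁` and `E₁₁ - E₂₂` is
scalar — so in two dimensions, too, the energy is the only zeroth-order Lyapunov density (the 2D-specific monotone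
quantities, enstrophy and the Casimirs `∫ f(ω)`, are densities of FIRST order in `∇u`). -/
theorem scalar_of_commute_swaps_two (M : Matrix (Fin 2) (Fin 2) ℝ)
    (h01 : M * !![0, 1; 1, 0] = !![0, 1; 1, 0] * M)
    (hdg : M * !![1, 0; 0, -1] = !![1, 0; 0, -1] * M) :
    M = M 0 0 • (1 : Matrix (Fin 2) (Fin 2) ℝ) := by
  have e := fun i j => congrFun (congrFun h01 i) j
  have f := fun i j => congrFun (congrFun hdg i) j
  have a00 := e 0 0
  have a01 := e 0 1
  have b01 := f 0 1
  have b10 := f 1 0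
  simp [Matrix.mul_apply, Fin.sum_univ_two] at a00 a01 b01 b10
  ext i j
  fin_cases i <;> fin_cases j <;> simp <;> linarith

/-- BIDEGREE COLLISION RULE of the first-order programme (report §2.8, census (t)).  For a density of bidegree
`(a, b)` in `(u, ∇u)` evaluated on the two-parameter family `λ u₀(x/L)`, `ε = 1/L`, the Euler rate scales as
`λ^(a+b+1) ε^(b+1)` and the viscous rate as `λ^(a+b) ε^(b+2)`.  Two such monomials coincide exactly when the viscous
one comes from bidegree `(a+2, b-1)`: the Euler rate of a piece is screened only by the dissipation of the piece with
two more powers of `u` and one fewer of `∇u`. -/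
theorem bidegree_collision (a b a' b' : ℕ) :
    (a + b + 1 = a' + b' ∧ b + 1 = b' + 2) ↔ (a' = a + 2 ∧ b = b' + 1) := by
  omega

end Summit.NavierStokesRegularity.NavierStokesRegularity.Theorems
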